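import Literature.Geometry.Lorentzian.KerrNullShearFree
import Literature.Geometry.Lorentzian.KerrSchildDivergence

/-!
# Triage r2-3 (gen 2) — degenerate-instance check of `radius_anti_horizon`
(card `three-clocks-pinched-development`, `Cruxes/KerrShieldedSettles/SketchIdeator5.lean`)

The sketch states `radius_anti_horizon` WITHOUT a sub-extremality hypothesis.  For `|a| > M`
the tree's `Kerr.rPlus M a = M + √(M² − a²)` takes the junk value `M` (`Real.sqrt` of a
negative number is `0`), the hypothesis `r(x) = r₊` then says `r(x) = M`, and at such a point
`Δ = a² − M² > 0`: `dr` is a SPACELIKE covector, so outgoing future-timelike vectors exist.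
Explicit witness: `M = 1`, `a = 2`, `x = (0, √5, 0, 0)` (`r = 1 = r₊`, `H = 1`, `Σ = 1`),
`v = (1, √5/15, 11√5/30, 0)`: `g(v,v) = −1/12 < 0`, `v⁰ = 1 > 0`, `dr(v) = +1/3 > 0`.
So the literal statement is false; adding `(ha : |a| ≤ M)` (or `Kerr.IsSubextremal M a`, which
the crux supplies anyway) repairs it.  The companion `radius_strictAnti_hole` is protected
(`r₋ < r < r₊` is unsatisfiable off sub-extremality).
-/

noncomputable section

open Literature.Geometry.Lorentzian

namespace TriageR2K3

/-- Verbatim the statement of `Ideator5.radius_anti_horizon` (SketchIdeator5.lean l.57–61). -/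
def RadiusAntiHorizon : Prop :=
  ∀ {M a : ℝ} (_hM : 0 ≤ M) {x : E4}
    (_h : Kerr.radius a x = Kerr.rPlus M a) (_hx0 : 0 < Kerr.radius a x) {v : E4}
    (_hv : Kerr.bilin M a x v v ≤ 0) (_hv0 : 0 < v 0),
    fderiv ℝ (Kerr.radius a) x v ≤ 0

/-- The witness point `x = (0, √5, 0, 0)`. -/
def xw : E4 := WithLp.toLp 2 ![0, Real.sqrt 5, 0, 0]

/-- The witness vector `v = (1, √5/15, 11√5/30, 0)` (future timelike, outgoing). -/
def vw : E4 := WithLp.toLp 2 ![1, Real.sqrt 5 / 15, 11 * Real.sqrt 5 / 30, 0]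

@[simp] theorem xw_zero : xw 0 = 0 := rfl
@[simp] theorem xw_one : xw 1 = Real.sqrt 5 := rfl
@[simp] theorem xw_two : xw 2 = 0 := rfl
@[simp] theorem xw_three : xw 3 = 0 := rfl
@[simp] theorem vw_zero : vw 0 = 1 := rfl
@[simp] theorem vw_one : vw 1 = Real.sqrt 5 / 15 := rfl
@[simp] theorem vw_two : vw 2 = 11 * Real.sqrt 5 / 30 := rfl
@[simp] theorem vw_three : vw 3 = 0 := rfl

theorem sqrt5_sq : Real.sqrt 5 ^ 2 = 5 := Real.sq_sqrt (by norm_num)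

theorem spatialNorm_sq_xw : E4.spatialNorm xw ^ 2 = 5 := by
  rw [E4.spatialNorm_sq, xw_one, xw_two, xw_three, sqrt5_sq]
  norm_num

/-- `r(x) = 1` at the witness point (positive root of the quartic). -/
theorem radius_xw : Kerr.radius 2 xw = 1 := by
  apply Kerr.radius_eq_of_pos_of_quartic one_pos
  rw [spatialNorm_sq_xw, xw_three]
  norm_num

/-- `r₊(1, 2) = 1` (junk value of the super-extremal horizon radius). -/
theorem rPlus_one_two : Kerr.rPlus 1 2 = 1 := by
  unfold Kerr.rPlus
  rw [Real.sqrt_eq_zero'.mpr (by norm_num)]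
  norm_num

theorem scalarH_xw : Kerr.scalarH 1 2 xw = 1 := by
  unfold Kerr.scalarH
  rw [radius_xw, xw_three]
  norm_num

theorem nullCovector_xw_vw : Kerr.nullCovector 2 xw vw = 1 / 3 := by
  rw [Kerr.nullCovector, E4.covector_apply]
  simp only [Kerr.nullCovectorFun, radius_xw, Fin.sum_univ_four, xw_one, xw_two,
    xw_three, vw_zero, vw_one, vw_two, vw_three, Matrix.cons_val_zero, Matrix.cons_val_one,
    Matrix.cons_val, Fin.isValue]
  have h5 := sqrt5_sq
  field_simp
  nlinarith [h5]

theorem minkowski_vw : Minkowski.bilin vw vw = -11 / 36 := by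
  rw [Minkowski.bilin_apply]
  simp only [Fin.sum_univ_three, Fin.isValue, vw_zero]
  have e1 : vw (Fin.succ 0) = Real.sqrt 5 / 15 := rfl
  have e2 : vw (Fin.succ 1) = 11 * Real.sqrt 5 / 30 := rfl
  have e3 : vw (Fin.succ 2) = 0 := rfl
  rw [e1, e2, e3]
  have h5 := sqrt5_sq
  nlinarith [h5]

theorem bilin_xw_vw : Kerr.bilin 1 2 xw vw vw = -1 / 12 := by
  rw [Kerr.bilin_apply, minkowski_vw, scalarH_xw, nullCovector_xw_vw]
  norm_num

theorem fderiv_radius_xw_vw : fderiv ℝ (Kerr.radius 2) xw vw = 1 / 3 := by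
  have hx0 : 0 < Kerr.radius 2 xw := by rw [radius_xw]; norm_num
  rw [Kerr.fderiv_radius_apply hx0, Kerr.blSigma_spatial_eq, radius_xw, spatialNorm_sq_xw]
  simp only [xw_one, xw_two, xw_three, vw_one, vw_two, vw_three]
  have h5 := sqrt5_sq
  have h5' : Real.sqrt 5 / 15 * Real.sqrt 5 = 1 / 3 := by nlinarith [h5]
  rw [show Real.sqrt 5 / 15 * Real.sqrt 5 + 11 * Real.sqrt 5 / 30 * 0 + (0:ℝ) * 0
      = Real.sqrt 5 / 15 * Real.sqrt 5 by ring, h5']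
  norm_num

/-- **The literal `radius_anti_horizon` is false** (super-extremal junk instance). -/
theorem not_radiusAntiHorizon : ¬ RadiusAntiHorizon := by
  intro h
  have hx0 : 0 < Kerr.radius 2 xw := by rw [radius_xw]; norm_num
  have hr : Kerr.radius 2 xw = Kerr.rPlus 1 2 := by rw [radius_xw, rPlus_one_two]
  have hv : Kerr.bilin 1 2 xw vw vw ≤ 0 := by rw [bilin_xw_vw]; norm_num
  have hv0 : 0 < vw 0 := by rw [vw_zero]; norm_num
  have key := h (M := 1) (a := 2) (by norm_num) hr hx0 hv hv0
  rw [fderiv_radius_xw_vw] at key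
  norm_num at key

/-- The REPAIRED statement needs `|a| ≤ M`; with it the witness is excluded (`|2| ≤ 1` fails). -/
example : ¬ (|(2:ℝ)| ≤ 1) := by norm_num

end TriageR2K3

end
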